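/-
Copyright (c) 2026 the pub-hodgecm-mathlib formalisation cell (harness21).  Prover seat hodgecm-mathlib-A-p17 (g20), floor 0, programme P5
(Alb-CM), in-house road for the letter L4if (ROAD CARD v3 §8, A-p18 (g23)), recipe STEP 3, file 1 of 2.  KERNEL module: THEOREMS ONLY
(no definition, no named fact, no `sorry`, no instance, no notation).
-/
import Summits.HodgeConjecture.HodgeConjecture.Theorems.F0P5CurveThetaCompanionLocalDetTwist
import Literature.NumberTheory.Automorphic.Liu2021.LemD1RankTwoCMLetters
import Literature.NumberTheory.Automorphic.Liu2021.Def411IrreducibleOfLemD1AsPrinted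
import HarnessLib

/-!
# F0 · P5 pay-down line `Cruxes/HLiu418/Lines/F0_P5_CurveThetaLettersPaydown` (ED. 7), letter L4if, recipe step 3 (file 1 of 2):
# a det-twist between two local Weil factors on `k ⊗ 1` DESCENDS TO THE TWISTED COINVARIANTS; the twist datum `α₀(u) = χ(u_f)`

Cell `hodgecm-mathlib`, floor 0, programme P5 (Alb-CM); crux item `stmt-HodgeConjecture-24832`
(`Summit.HodgeConjecture.HodgeConjecture.Theses.HCCMUnconditional.HLiu418`).  Sequel of ★ `F0P5CurveThetaCompanionLocalDetTwist` (B2: the LOCAL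
form `ω_{θ′,v}(k ⊗ 1) = α((det k)_v) • ω_{θ,v}(k ⊗ 1)` for `θ′ = θ·α̃`), written for step 3 of the assembler's recipe of the in-house road for the
last local letter of #74, `Liu2021.LemD1RankTwoCMLetters.LemD1_4IfAsPrintedNonsplitCM₂` (road card `F0/P5/A-p18/g23/ROAD-L4if-v3.A-p18g23.md`
§8; the assembler is A-p18 (g24)).  Pure bookkeeping over ★ `TwistedCoinv` and the tree's unitary-group place dictionary:

* §1 **generic descent** `exists_coinv_equiv_of_omegaLoc_localLineInl_eq_smul`: for two families `𝓣, 𝓣′` of local splittings of the big group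
  `U(J_V ⊗ J_W)` (a LINE `J_W`) whose local Weil representations at `v` differ on `k ⊗ 1` by a scalar `c(k)`, and centre characters `ξ′ = c(z·1_N)·ξ`
  of `U(J_W)(F_v) = E_v¹`: `∃ T : Coinv(ω′_v ∘ (z·1_n), ξ′) ≃ₗ[ℂ] Coinv(ω_v ∘ (z·1_n), ξ)` with `T ∘ Θ′_{ξ′}(k) = c(k) • Θ_ξ(k) ∘ T`, in the currency
  `TwistedCoinv.rep ξ (𝓣.omegaLoc v) (commute_omegaLoc_localCenter …) (localLineInl … k)` of ★ `quotEquivLocalType₂` ∕ `areIsomorphicRep_localType₂_iff_quot`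
  (★ `TwistedCoinv.mapEquiv` with `T = id` + ★ `localLineInl_localCenter`; the `∃ E, E ∘ rep_b = c • rep_k ∘ E` shape of ★ (C4)-core);
* §2 **the centre through the place dictionary**: `inclPlace v (z·1_N) = (det (inclPlace v z))·1_N` and
  `det (1, inclPlace v (z·1_N)) = (1, det (inclPlace v z))^N` in `U(1)(𝔸_F)` (★ `adelicDet_finCenterAdelic`);
* §3 **the twist datum `α₀(u) = χ(u_f)`** on `U(1)(𝔸_{L⁺})` for an automorphic `χ ∈ Chi`: it exists as a homomorphism, is continuous, automorphic and
  unitary, its Hecke character `α̃₀(d) = α₀(d/d̄)` (★ `ratioHecke`) IS Liu's `χ̌` (so the companion label `Λ′ = Λᶜ·χ̌` of [Liu2021, Lem. D.1 (4)] reads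
  `Λ′ = Λᶜ·α̃₀`, the hypothesis shape of ★ B2 at `θ := Λᶜ`), and on the local centre `α₀(det (1, inclPlace v (z·1_N))) = χ_v(z)^N`
  (`χ_v = localCharOfCenter … χ v`).

File 2 (`F0P5CurveThetaCompanionGalConjCoinvariants`) instantiates: B2 at the companion pair `(Λᶜ, Λ′)` and the step-3 head on the members'
twisted coinvariants.  Why `(Λᶜ, Λ′)` and not R2G's `(Λ, Λ′)` with `α = Λ⁻¹χ_f`: the det-twist `χ_{v,f} ∘ det` between `Θ(Λ′)` and `Θ(Λᶜ)` is the one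
cancelled by the `ξ ∘ det⁻¹` of ★ (C4b) `exists_coinv_equiv_galConj_similitude_models` (the Galois-conjugation ∕ rational-similitude transport
`Θ_{ξ∘bar₁}(Λᶜ, −a) ≅ (ξ∘det⁻¹) ⊗ Θ_ξ(Λ, (det T_a)⁻¹a)`), while `Λ_w⁻¹χ_v ∘ det` is not a twist the road can remove.

HONEST LABEL: HC_CM is proved only modulo the printed citations — the 2 remaining named inputs (hLiu418, h413) — until rung 0 closes; this
file proves helper lemmas toward ONE registered letter stub (L4if) of ONE floor-0 pay-down line and discharges no letter by itself.

## References
* [Liu2021] Y. Liu, *Fourier–Jacobi cycles and arithmetic relative trace formula*, Camb. J. Math. 9 (2021) = arXiv:2102.11518: Def. 4.11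
  (l. 2083–2097), App. D §D.1 Steps 1–3 (l. 5214–5221), §D.1 l. 5224 (`χ̌`), Lem. D.1 (4) (p. 126, l. 5235).
* [GelbartRogawski1991] S. Gelbart, J. Rogawski, *L-functions and Fourier–Jacobi coefficients for the unitary group U(3)*, Invent. Math. 105
  (1991), §3.1 Prop. 3.1.1 p. 455 L1–3, Remark p. 457 L4–13.
* [MoeglinVignerasWaldspurger1987] C. Mœglin, M.-F. Vignéras, J.-L. Waldspurger, *Correspondances de Howe sur un corps p-adique*, LNM 1291
  (1987), Chap. 2 II.2, Chap. 3 IV.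
* [Mok2014] C. P. Mok, Mem. AMS 235 (2015), §1 Notation p. 5.  [PlatonovRapinchuk1994] V. Platonov, A. Rapinchuk, *Algebraic Groups and Number
  Theory* (1994), §5.1.
-/

set_option autoImplicit false
set_option linter.dupNamespace false

noncomputable section

open NumberField NumberField.InfinitePlace NumberField.mixedEmbedding IsDedekindDomain
open scoped Matrix Kronecker ComplexOrder RestrictedProduct Classical
open Literature.NumberTheory.Automorphic Literature.NumberTheory.Automorphic.UnitaryGroup
open Literature.NumberTheory.Automorphic.Liu2021 Literature.NumberTheory.Automorphic.Liu2021.Def411WeilCarriers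
open Literature.NumberTheory.Automorphic.Liu2021.Def411WeilCarriersDoubling
open Literature.NumberTheory.GaloisRepresentations Literature.NumberTheory.Automorphic.IdeleClassGroup
open Literature.NumberTheory.GelbartRogawski1991 Literature.NumberTheory.GelbartRogawski1991.UnitaryDualPair
open Literature.NumberTheory.GelbartRogawski1991.UnitaryDualPair.WeilCoinv
open Literature.NumberTheory.GelbartRogawski1991.UnitaryDualPair.LocalSplitting
open Literature.NumberTheory.GelbartRogawski1991.GRConstruction
open Literature.NumberTheory.GelbartRogawski1991.GRConstruction.DoubledWeilDetTwist
open Literature.NumberTheory.Weil1964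
open Literature.RepresentationTheory (TwistedCoinv.Coinv TwistedCoinv.rep TwistedCoinv.mapEquiv TwistedCoinv.mapEquiv_rep)
open Literature.RepresentationTheory.Liu2021 Literature.RepresentationTheory.HarrisKudlaSweet1996

namespace Summit.HodgeConjecture.HodgeConjecture.Cruxes.HLiu418.F0P5CurveThetaCompanionDetTwist

/-! ## §1 Generic descent: a scalar twist on `k ⊗ 1` between two local Weil factors descends to the twisted coinvariants -/

section Generic

variable (F E : Type) [Field F] [NumberField F] [Field E] [NumberField E] [Algebra F E]
variable (c : E ≃ₐ[F] E) (N : ℕ) {n : ℕ} (e : Fin N × Fin 1 ≃ Fin n)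
variable (JV : Matrix (Fin N) (Fin N) E) (JW : Matrix (Fin 1) (Fin 1) E)
variable {TV : Matrix (Fin N) (Fin N) F} {TW : Matrix (Fin 1) (Fin 1) F}
variable [Algebra.IsQuadraticExtension F E] {δ : E} (hcδ : c δ = -δ) (hδ : δ ≠ 0) {d : F}
  (hd : δ * δ = algebraMap F E d) (hV : TV.IsSymm) (hW : TW.IsSymm)
  (hJV : JV = TV.map (algebraMap F E)) (hJW : JW = TW.map (algebraMap F E)) (hJW0 : JW 0 0 ≠ 0)

set_option maxHeartbeats 400000 in
/-- **Generic descent.**  Two families `𝓣`, `𝓣′` of local splittings of the big group `U(J_V ⊗ J_W)` whose local Weil representations at `v`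
differ on `k ⊗ 1` (`k ∈ U(J_V)(F_v)`) by the scalar `c(k)`: for centre characters `ξ`, `ξ′` of `U(J_W)(F_v) = E_v¹` with
`ξ′(z) = c(z·1_N) ξ(z)`, the identity of `𝒮(F_v^n)` descends to `E : Coinv(ω′_v ∘ (z·1_n), ξ′) ≃ Coinv(ω_v ∘ (z·1_n), ξ)` with
`E ∘ Θ′(k) = c(k) • Θ(k) ∘ E` (`Θ(k) = TwistedCoinv.rep ξ ω_v _ (k ⊗ 1)`), i.e. `Θ′_ξ′ ≅ c ⊗ Θ_ξ`.  (★ `TwistedCoinv.mapEquiv` with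
`T = id`, multiplier `z ↦ c(z·1_N)` through ★ `localLineInl_localCenter`.) [cite: GelbartRogawski1991, §3.1 Remark p. 457 L4–13]
[cite: Liu2021, App. D §D.1 Step 3 (l. 5221)] -/
theorem exists_coinv_equiv_of_omegaLoc_localLineInl_eq_smul
    (𝓣 𝓣' : FinLocalSplittings F E c n hcδ hδ hd (gram F e TV TW) (isSymm_gram F e hV hW) (reindex_kronecker_eq_gram_map F E e hJV hJW))
    (v : HeightOneSpectrum (𝓞 F)) (cf : UnitaryGroup.localPi E c N JV v → ℂˣ)
    (h : ∀ (k : UnitaryGroup.localPi E c N JV v) (Φ : SchwartzBruhat (Fin n → v.adicCompletion F)),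
      𝓣'.omegaLoc v (UnitaryGroup.localLineInl E c N e JV JW v k) Φ =
        ((cf k : ℂˣ) : ℂ) • 𝓣.omegaLoc v (UnitaryGroup.localLineInl E c N e JV JW v k) Φ)
    (ξ ξ' : UnitaryGroup.localPi E c 1 JW v →* ℂˣ)
    (hξ : ∀ z, ξ' z = cf (localCenter E c N JV JW hJW0 v z) * ξ z) :
    ∃ T : TwistedCoinv.Coinv (show Representation ℂ (UnitaryGroup.localPi E c 1 JW v) (SchwartzBruhat (Fin n → v.adicCompletion F)) from
          (𝓣'.omegaLoc v).comp (localCenter E c n (Matrix.reindex e e (JV ⊗ₖ JW)) JW hJW0 v)) ξ' ≃ₗ[ℂ]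
        TwistedCoinv.Coinv (show Representation ℂ (UnitaryGroup.localPi E c 1 JW v) (SchwartzBruhat (Fin n → v.adicCompletion F)) from
          (𝓣.omegaLoc v).comp (localCenter E c n (Matrix.reindex e e (JV ⊗ₖ JW)) JW hJW0 v)) ξ,
      ∀ (k : UnitaryGroup.localPi E c N JV v)
        (y : TwistedCoinv.Coinv (show Representation ℂ (UnitaryGroup.localPi E c 1 JW v) (SchwartzBruhat (Fin n → v.adicCompletion F)) from
          (𝓣'.omegaLoc v).comp (localCenter E c n (Matrix.reindex e e (JV ⊗ₖ JW)) JW hJW0 v)) ξ'),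
        T (TwistedCoinv.rep ξ' (𝓣'.omegaLoc v) (commute_omegaLoc_localCenter F E c N e JV JW hcδ hδ hd hV hW hJV hJW hJW0 𝓣' v)
            (UnitaryGroup.localLineInl E c N e JV JW v k) y) =
          ((cf k : ℂˣ) : ℂ) • TwistedCoinv.rep ξ (𝓣.omegaLoc v) (commute_omegaLoc_localCenter F E c N e JV JW hcδ hδ hd hV hW hJV hJW hJW0 𝓣 v)
            (UnitaryGroup.localLineInl E c N e JV JW v k) (T y) := by
  have hT : ∀ (z : UnitaryGroup.localPi E c 1 JW v) (Φ : SchwartzBruhat (Fin n → v.adicCompletion F)),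
      (show Representation ℂ (UnitaryGroup.localPi E c 1 JW v) (SchwartzBruhat (Fin n → v.adicCompletion F)) from
          (𝓣'.omegaLoc v).comp (localCenter E c n (Matrix.reindex e e (JV ⊗ₖ JW)) JW hJW0 v)) z
          ((LinearEquiv.refl ℂ (SchwartzBruhat (Fin n → v.adicCompletion F))) Φ) =
        ((cf (localCenter E c N JV JW hJW0 v z) : ℂˣ) : ℂ) •
          (LinearEquiv.refl ℂ (SchwartzBruhat (Fin n → v.adicCompletion F)))
            ((show Representation ℂ (UnitaryGroup.localPi E c 1 JW v) (SchwartzBruhat (Fin n → v.adicCompletion F)) from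
              (𝓣.omegaLoc v).comp (localCenter E c n (Matrix.reindex e e (JV ⊗ₖ JW)) JW hJW0 v)) z Φ) := fun z Φ => by
    have e1 := h (localCenter E c N JV JW hJW0 v z) Φ
    rw [localLineInl_localCenter] at e1
    exact e1
  refine ⟨(TwistedCoinv.mapEquiv _ ξ _ ξ' (LinearEquiv.refl ℂ (SchwartzBruhat (Fin n → v.adicCompletion F)))
    (fun z => cf (localCenter E c N JV JW hJW0 v z)) hT hξ).symm, fun k y => ?_⟩
  have key := TwistedCoinv.mapEquiv_rep _ ξ _ ξ' (𝓣.omegaLoc v) (𝓣'.omegaLoc v)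
    (commute_omegaLoc_localCenter F E c N e JV JW hcδ hδ hd hV hW hJV hJW hJW0 𝓣 v)
    (commute_omegaLoc_localCenter F E c N e JV JW hcδ hδ hd hV hW hJV hJW hJW0 𝓣' v)
    (LinearEquiv.refl ℂ (SchwartzBruhat (Fin n → v.adicCompletion F))) (fun z => cf (localCenter E c N JV JW hJW0 v z)) hT hξ
    (g := UnitaryGroup.localLineInl E c N e JV JW v k) (g' := UnitaryGroup.localLineInl E c N e JV JW v k) (a := ((cf k : ℂˣ) : ℂ))
    (fun Φ => h k Φ)
    ((TwistedCoinv.mapEquiv _ ξ _ ξ' (LinearEquiv.refl ℂ (SchwartzBruhat (Fin n → v.adicCompletion F)))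
      (fun z => cf (localCenter E c N JV JW hJW0 v z)) hT hξ).symm y)
  rw [LinearEquiv.apply_symm_apply] at key
  rw [key, map_smul, LinearEquiv.symm_apply_apply]

end Generic

/-! ## §2 Bookkeeping: `det` of the local centre `z·1_N` pushed to `U(J)(𝔸_F)` is `(1, z)^N` -/

section Center

variable (F E : Type) [Field F] [NumberField F] [Field E] [NumberField E] [Algebra F E]
variable (c : E ≃ₐ[F] E) (N : ℕ) (J : Matrix (Fin N) (Fin N) E) (J₁ : Matrix (Fin 1) (Fin 1) E)

/-- **the place inclusion of the local centre is the finite-adelic centre of the place inclusion**: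
`inclPlace v (z·1_N) = (det (inclPlace v z))·1_N` in `U(J)(𝔸_{F,f})` (components: `z·1_N` at `v`, `1` elsewhere, on both sides).
[cite: Mok2014, §1 Notation p. 5] [cite: PlatonovRapinchuk1994, §5.1] -/
theorem inclPlace_localCenter (hJ₁ : J₁ 0 0 ≠ 0) (v : HeightOneSpectrum (𝓞 F)) (z : UnitaryGroup.localPi E c 1 J₁ v) :
    UnitaryGroup.inclPlace F E c N J v (localCenter E c N J J₁ hJ₁ v z) =
      UnitaryGroup.finAdelicCenter F E c N J
        (finAdelicCenterInv F E c J₁ hJ₁ (UnitaryGroup.inclPlace F E c 1 J₁ v z)) := by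
  refine UnitaryGroup.eq_of_forall_evalPlace_eq F E c N J fun w => ?_
  change _ = UnitaryGroup.finAdelicEquiv F E c N J _ w
  rw [finAdelicEquiv_finAdelicCenter F E c N J J₁ hJ₁, finAdelicCenter_finAdelicCenterInv]
  change _ = localCenter E c N J J₁ hJ₁ w (UnitaryGroup.evalPlace F E c 1 J₁ w (UnitaryGroup.inclPlace F E c 1 J₁ v z))
  by_cases hw : w = v
  · subst hw
    rw [UnitaryGroup.evalPlace_inclPlace, UnitaryGroup.evalPlace_inclPlace]
  · rw [UnitaryGroup.evalPlace_inclPlace_of_ne F E c N J hw, UnitaryGroup.evalPlace_inclPlace_of_ne F E c 1 J₁ hw, map_one]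

/-- **`det` of the local centre, read in `U(1)(𝔸_F)`**: `det ((1, inclPlace v (z·1_N))) = (1, det (inclPlace v z))^N` — the norm-one idèle with
`v`-component `z^N` (as `z·z̄ = 1`) and all other components `1`.  (§2 + ★ `adelicDet_finCenterAdelic`.) [cite: Mok2014, §1 Notation p. 5] -/
theorem adelicDet_finAdelicToAdelic_inclPlace_localCenter (hJ : J.det ≠ 0) (hJ₁ : J₁ 0 0 ≠ 0) (v : HeightOneSpectrum (𝓞 F))
    (z : UnitaryGroup.localPi E c 1 J₁ v) :
    UnitaryGroup.adelicDet F E c N J hJ (UnitaryGroup.finAdelicToAdelic F E c N J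
        (UnitaryGroup.inclPlace F E c N J v (localCenter E c N J J₁ hJ₁ v z))) =
      ⟨finiteIdele E ((finAdelicCenterInv F E c J₁ hJ₁ (UnitaryGroup.inclPlace F E c 1 J₁ v z) : UnitaryGroup.finAdelicOne F E c) :
          (FiniteAdeleRing (𝓞 E) E)ˣ),
        finiteIdele_mem_adelicOne F E c (finAdelicCenterInv F E c J₁ hJ₁ (UnitaryGroup.inclPlace F E c 1 J₁ v z))⟩ ^ N := by
  rw [inclPlace_localCenter, ← UnitaryGroup.finCenterAdelic_apply, adelicDet_finCenterAdelic]

end Center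

/-! ## §3 The twist datum `α₀(u) = χ(u_f)` on `U(1)(𝔸_{L⁺})`: existence, continuity, automorphy, unitarity, `α̃₀ = χ̌`, value on the centre -/

section AlphaChi

variable (L : Type) [Field L] [NumberField L] [IsCMField L]
variable (χ : Chi (↥(maximalRealSubfield L)) L (IsCMField.complexConj L))

/-- **the twist datum `α₀(u) = χ(u_f)` exists as a homomorphism** `U(1)(𝔸_{L⁺}) →* ℂˣ` (`χ` precomposed with the finite part, ★
`finitePart_mem_finAdelicOne`). [cite: Liu2021, Def. 4.11 (l. 2090), App. D §D.1 (l. 5224)] -/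
theorem exists_alphaChi :
    ∃ α₀ : UnitaryGroup.adelicOne (↥(maximalRealSubfield L)) L (IsCMField.complexConj L) →* ℂˣ,
      ∀ u, α₀ u = χ.1 ⟨finitePart L (u : ideleGroup L),
        finitePart_mem_finAdelicOne (↥(maximalRealSubfield L)) L (IsCMField.complexConj L) u.2⟩ :=
  ⟨χ.1.comp (((finitePart L).comp (UnitaryGroup.adelicOne (↥(maximalRealSubfield L)) L (IsCMField.complexConj L)).subtype).codRestrict
      (UnitaryGroup.finAdelicOne (↥(maximalRealSubfield L)) L (IsCMField.complexConj L))
      fun u => finitePart_mem_finAdelicOne (↥(maximalRealSubfield L)) L (IsCMField.complexConj L) u.2),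
    fun _ => rfl⟩

variable {L χ}
variable (α₀ : UnitaryGroup.adelicOne (↥(maximalRealSubfield L)) L (IsCMField.complexConj L) →* ℂˣ)
  (hα₀ : ∀ u, α₀ u = χ.1 ⟨finitePart L (u : ideleGroup L),
    finitePart_mem_finAdelicOne (↥(maximalRealSubfield L)) L (IsCMField.complexConj L) u.2⟩)

include hα₀

/-- `α₀` is continuous (`χ` is, the finite part is a coordinate projection). [cite: Liu2021, Def. 4.11 (l. 2090)] -/
theorem continuous_alphaChi : Continuous α₀ := by
  have h : Continuous fun u : ↥(UnitaryGroup.adelicOne (↥(maximalRealSubfield L)) L (IsCMField.complexConj L)) =>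
      χ.1 ⟨finitePart L (u : ideleGroup L),
        finitePart_mem_finAdelicOne (↥(maximalRealSubfield L)) L (IsCMField.complexConj L) u.2⟩ := by
    refine χ.2.1.comp (Continuous.subtype_mk ?_ _)
    exact (Continuous.units_map _ continuous_snd).comp continuous_subtype_val
  exact h.congr fun u => (hα₀ u).symm

/-- `α₀` is AUTOMORPHIC: trivial on the principal norm-one idèles `(k)`, `k ∈ L¹` (`(k)_f` is the diagonal image of the rational
norm-one element `k`, on which `χ` is trivial). [cite: Liu2021, Def. 4.11 (l. 2090)] -/
theorem alphaChi_eq_one_of_mem_principalIdeles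
    (u : UnitaryGroup.adelicOne (↥(maximalRealSubfield L)) L (IsCMField.complexConj L))
    (hu : (u : ideleGroup L) ∈ principalIdeles L) : α₀ u = 1 := by
  rw [hα₀]
  obtain ⟨k, hk⟩ := hu
  have hmem : Units.map (algebraMap L (FiniteAdeleRing (𝓞 L) L)).toMonoidHom k ∈
      UnitaryGroup.finAdelicOne (↥(maximalRealSubfield L)) L (IsCMField.complexConj L) := by
    have h1 : finitePart L (u : ideleGroup L) = Units.map (algebraMap L (FiniteAdeleRing (𝓞 L) L)).toMonoidHom k :=
      Units.ext (by rw [← hk]; rfl)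
    exact h1 ▸ finitePart_mem_finAdelicOne (↥(maximalRealSubfield L)) L (IsCMField.complexConj L) u.2
  have key : (⟨finitePart L (u : ideleGroup L),
      finitePart_mem_finAdelicOne (↥(maximalRealSubfield L)) L (IsCMField.complexConj L) u.2⟩ :
        ↥(UnitaryGroup.finAdelicOne (↥(maximalRealSubfield L)) L (IsCMField.complexConj L))) =
      ⟨Units.map (algebraMap L (FiniteAdeleRing (𝓞 L) L)).toMonoidHom k, hmem⟩ :=
    Subtype.ext (Units.ext (show ((u : ideleGroup L) : AdeleRing (𝓞 L) L).2 = algebraMap L (FiniteAdeleRing (𝓞 L) L) k by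
      rw [← hk]; rfl))
  rw [key]
  exact χ.2.2 k hmem

/-- `α₀` is UNITARY (automorphic `χ` is — ★ `norm_chi_apply_eq_one_cm`). [cite: Liu2021, Def. 4.11 (l. 2090)] -/
theorem norm_alphaChi (u : UnitaryGroup.adelicOne (↥(maximalRealSubfield L)) L (IsCMField.complexConj L)) :
    ‖((α₀ u : ℂˣ) : ℂ)‖ = 1 := by
  rw [hα₀]
  exact norm_chi_apply_eq_one_cm L χ _

/-- **`α̃₀ = χ̌`**: the Hecke character `d ↦ α₀(d/d̄)` (★ `ratioHecke`) IS Liu's `χ̌(x) = χ(x_f/x_fᶜ)` (★ `HeckeCharacter.checkOfChi`), pointwise.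
[cite: Liu2021, App. D §D.1 (l. 5224)] [cite: GelbartRogawski1991, §3.1 Remark p. 457 L4–13] -/
theorem ratioHecke_alphaChi_eq_checkOfChi (hcc : (IsCMField.complexConj L) * (IsCMField.complexConj L) = 1) (hc : Continuous α₀)
    (hrat : ∀ u : UnitaryGroup.adelicOne (↥(maximalRealSubfield L)) L (IsCMField.complexConj L),
      (u : ideleGroup L) ∈ principalIdeles L → α₀ u = 1) :
    ratioHecke L α₀ hc hrat = HeckeCharacter.checkOfChi hcc χ := by
  refine HeckeCharacter.ext fun d => ?_
  -- both sides are `χ` of the finite idèle `d_f / d_f^c` (definitionally, after the three unfoldings)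
  rw [ratioHecke_apply, hα₀, CheckOfChi.checkOfChi_apply]
  congr 1

/-- **(T1′) the companion label through `α₀`**: `Λᶜ · χ̌ = Λᶜ · α̃₀` — so `Λ′ = Λᶜ·χ̌` reads `Λ′ = Λᶜ · ratioHecke α₀`, the hypothesis shape of ★ B2.
[cite: Liu2021, App. D §D.1 (l. 5224), Lem. D.1 (4) (l. 5235)] [cite: GelbartRogawski1991, §3.1 Remark p. 457 L4–13] -/
theorem toHeckeCharacter_galConj_mul_checkOfChi_eq_mul_ratioHecke_alphaChi
    (lam : Literature.NumberTheory.Automorphic.IdeleClassGroup L →ₜ* Circle)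
    (hcc : (IsCMField.complexConj L) * (IsCMField.complexConj L) = 1) (hc : Continuous α₀)
    (hrat : ∀ u : UnitaryGroup.adelicOne (↥(maximalRealSubfield L)) L (IsCMField.complexConj L),
      (u : ideleGroup L) ∈ principalIdeles L → α₀ u = 1) :
    toHeckeCharacter L (IdeleClassGroup.galConj (IsCMField.complexConj L) lam) * HeckeCharacter.checkOfChi hcc χ =
      toHeckeCharacter L (IdeleClassGroup.galConj (IsCMField.complexConj L) lam) * ratioHecke L α₀ hc hrat := by
  rw [ratioHecke_alphaChi_eq_checkOfChi α₀ hα₀ hcc hc hrat]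

/-- **`α₀ ∘ det` on the local centre is `χ_v^N`**: for `z ∈ U(J₁)(L⁺_v) = L_v¹`,
`α₀(det (1, inclPlace v (z·1_N))) = χ_v(z)^N` with `χ_v = localCharOfCenter … J₁ χ v` the local component of `χ` (§2 + ★ `finitePart_finiteIdele`
+ ★ `localCharOfCenter_eq_comp_inclPlace`). [cite: Liu2021, App. D §D.1 Step 3 (l. 5221)] [cite: Mok2014, §1 Notation p. 5] -/
theorem alphaChi_adelicDet_inclPlace_localCenter {N : ℕ} (J : Matrix (Fin N) (Fin N) L) (hJ : J.det ≠ 0)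
    (J₁ : Matrix (Fin 1) (Fin 1) L) (hJ₁ : J₁ 0 0 ≠ 0) (v : HeightOneSpectrum (𝓞 (↥(maximalRealSubfield L))))
    (z : UnitaryGroup.localPi L (IsCMField.complexConj L) 1 J₁ v) :
    α₀ (UnitaryGroup.adelicDet (↥(maximalRealSubfield L)) L (IsCMField.complexConj L) N J hJ
        (UnitaryGroup.finAdelicToAdelic (↥(maximalRealSubfield L)) L (IsCMField.complexConj L) N J
          (UnitaryGroup.inclPlace (↥(maximalRealSubfield L)) L (IsCMField.complexConj L) N J v
            (localCenter L (IsCMField.complexConj L) N J J₁ hJ₁ v z)))) =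
      localCharOfCenter (↥(maximalRealSubfield L)) L (IsCMField.complexConj L) J₁ hJ₁ χ.1 v z ^ N := by
  rw [adelicDet_finAdelicToAdelic_inclPlace_localCenter, map_pow, hα₀]
  -- `χ_v = χ ∘ det ∘ inclPlace v` definitionally (★ `localCharOfCenter_eq_comp_inclPlace`), and `(finiteIdele u)_f = u` (`rfl` inside `congr`)
  congr 1

end AlphaChi

end Summit.HodgeConjecture.HodgeConjecture.Cruxes.HLiu418.F0P5CurveThetaCompanionDetTwist

end
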